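import Literature.MathematicalPhysics.QuantumFieldTheory.Balaban1983to89.T3UnitLawGaugeInvariance
import Literature.MathematicalPhysics.QuantumFieldTheory.Balaban1983to89.CentreTwistBlockAvg

/-!
# `Balaban1983to89.T3CentreTwistUnitLaw` — the UNIT LAWS of the d = 3 Wilson scheme are invariant under 't Hooft's CENTRE
# TWISTS of the unit torus (every compact `G`, every central `z`, every measurable small-loop average `ℰ`, every `γ ≥ 0`)

Cell `ym3-torus` (HUMAN RULING D-0037, YM ladder rung R3), seat `ym3-torus-p2` gen 2.  WHAT THIS IS NOT: not d = 4, not infinite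
volume, not a mass gap, not Clay, not (E3): exact-symmetry bookkeeping at the level of LAWS, the unit-law twin of
`T3CentreSymmetry` (which is about the loop-string expectations): under (E3) it makes the continuum unit law of
`T3ContinuumUnitLaw` centre symmetric.

CONTENT.  ['t Hooft 1979] §2: multiplying every bond variable crossing one hyperplane `{x_μ = s}` of the periodic box by a central
element `z` (the twist `GaugeField.ctwist z μ s` of the tree's `CentreTwist`) leaves the Wilson action and the product Haar measure
invariant (`Missing.IsExpectSymmetry.ctwist`); [Balaban1987RG1] (0.4)/(2.17): the block averaging maps a fine twist to a coarse one
(`BlockAveraging.exists_iter_blockAvg_ctwist`, tree `CentreTwistBlockAvg`).  Hence: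
§1 `fieldShift_ctwist` — the level identifications of `T3LevelShift` intertwine the twists (slice read through `coordEquiv`);
   `map_ctwist_gibbsMeasure` — the normalised Gibbs MEASURE is twist invariant.
§2 **`map_ctwist_unitLaw : (unitLaw K).map (ctwist z μ s) = unitLaw K`** for every slice `s` of the unit torus: every unit twist
   is the image of a fine twist under `A_K = unitShift K ∘ avg^K`, and the Gibbs measure is invariant under the fine one.
-/

noncomputable section

open MeasureTheory Filter Topology
open Literature.MathematicalPhysics.QuantumFieldTheory.Balaban1983to89.T3ContinuumYM3Torus
open Literature.MathematicalPhysics.QuantumFieldTheory.Balaban1983to89.T3LevelShift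
open Literature.MathematicalPhysics.QuantumFieldTheory.Balaban1983to89.T3ThresholdRemoval
open Literature.MathematicalPhysics.QuantumFieldTheory.Balaban1983to89.Missing
open Literature.MathematicalPhysics.QuantumFieldTheory.Balaban1983to89.T4Continuum

namespace Literature.MathematicalPhysics.QuantumFieldTheory.Balaban1983to89.T3CentreTwistUnitLaw

/-- Two finite measures related by `∫ f ∘ φ dμ = ∫ f dν` for all measurable `f` with `|f| ≤ 1` satisfy `φ_* μ = ν`
(test on indicators; local helper). [folklore] -/
private theorem map_eq_of_integral_comp_eq {X Y : Type*} [MeasurableSpace X] [MeasurableSpace Y] {μ : Measure X}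
    {ν : Measure Y} [IsFiniteMeasure μ] [IsFiniteMeasure ν] {φ : X → Y} (hφ : Measurable φ)
    (h : ∀ f : Y → ℝ, Measurable f → (∀ y, |f y| ≤ 1) → ∫ x, f (φ x) ∂μ = ∫ y, f y ∂ν) : μ.map φ = ν := by
  refine Measure.ext fun s hs => ?_
  have hi : Measurable (s.indicator (1 : Y → ℝ)) := measurable_one.indicator hs
  have hb : ∀ y, |s.indicator (1 : Y → ℝ) y| ≤ 1 := fun y => by
    by_cases hy : y ∈ s
    · simp [hy]
    · simp [hy]
  have h1 := h _ hi hb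
  have h3 : (fun x => s.indicator (1 : Y → ℝ) (φ x)) = (φ ⁻¹' s).indicator 1 := by
    funext x
    by_cases hx : φ x ∈ s
    · simp [hx]
    · simp [hx]
  rw [Measure.map_apply hφ hs]
  have h2 : μ.real (φ ⁻¹' s) = ν.real s := by
    rw [← integral_indicator_one (hφ hs), ← integral_indicator_one hs, ← h1, h3]
  exact (ENNReal.toReal_eq_toReal_iff' (measure_ne_top _ _) (measure_ne_top _ _)).mp h2

/-! ## §1 The twists under the level identifications; the Gibbs measure is twist invariant -/

section Twist

variable {F : T3Family} {m K j m' K' j' : ℕ} {G : Type*} [GaugeGroup G]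

/-- **The level identification intertwines the centre twists**: a twist at the slice `s` of the source tower read through
`fieldShift h` is the twist at the slice `(coordEquiv h)⁻¹ s` of the target tower. [cite: tHooft1979Flux, §2] -/
theorem fieldShift_ctwist (h : (F.PP m K).sitesPerDir j = (F.PP m' K').sitesPerDir j') (z : G) (μ : Fin 3)
    (s : ZMod ((F.PP m' K').sitesPerDir j')) (V : GaugeField (F.PP m' K') j' G) :
    fieldShift h (GaugeField.ctwist z μ s V) = GaugeField.ctwist z μ ((coordEquiv h).symm s) (fieldShift h V) := by
  funext b
  have hiff : coordEquiv h (b.src μ) = s ↔ b.src μ = (coordEquiv h).symm s := by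
    constructor
    · intro hh
      rw [← hh, RingEquiv.symm_apply_apply]
    · intro hh
      rw [hh, RingEquiv.apply_symm_apply]
  simp only [fieldShift_apply, GaugeField.ctwist_apply, bondShift_dir, bondShift_src, siteShift_apply, hiff]
  split_ifs <;> first | rfl | contradiction

variable [MeasurableSpace G] [HaarData G] [RegularGaugeGroup G]

/-- **The normalised Gibbs MEASURE is invariant under every central twist** (`β ≥ 0`; the expectation symmetry
`Missing.IsExpectSymmetry.ctwist` of the tree, tested on indicators). [cite: tHooft1979Flux, §2] -/
theorem map_ctwist_gibbsMeasure {z : G} (hz : ∀ g : G, z * g = g * z) (P : Params) {β : ℝ} (hβ : 0 ≤ β) (μ : Fin P.d)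
    (s : ZMod (P.sitesPerDir 0)) :
    (T4GenFunBounds.gibbsMeasure P β).map (GaugeField.ctwist z μ s) = T4GenFunBounds.gibbsMeasure (G := G) P β := by
  haveI := T4GenFunBounds.isProbabilityMeasure_gibbsMeasure (G := G) P hβ
  refine map_eq_of_integral_comp_eq (GaugeField.measurePreserving_ctwist z μ s).measurable fun f _ _ => ?_
  rw [T4GenFunBounds.integral_gibbsMeasure_eq_expect P hβ, T4GenFunBounds.integral_gibbsMeasure_eq_expect P hβ]
  exact IsExpectSymmetry.ctwist hz μ s f

end Twist

/-! ## §2 The unit laws are twist invariant -/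

section UnitLaw

variable (F : T3Family) {G : Type*} [GaugeGroup G] [MeasurableSpace G] [HaarData G] [RegularGaugeGroup G]
  (ℰ : LoopAverage G) (hE : ℰ.MeasurableE) {γ : ℝ}

/-- **THE UNIT LAWS ARE CENTRE SYMMETRIC**: `(u ↦ ctwist z μ s u)_* unitLaw_K = unitLaw_K` for every central `z`, every axis `μ`
and every slice `s` of the unit torus (`γ ≥ 0`, measurable `ℰ`, every compact `G`): the unit twist at `s` is the `K`-fold
(0.4)-average of a fine twist (`BlockAveraging.exists_iter_blockAvg_ctwist` at the level-`K` slice `coordEquiv s`, then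
`fieldShift_ctwist`), under which the Gibbs measure is invariant. [cite: tHooft1979Flux, §2] -/
theorem map_ctwist_unitLaw {z : G} (hz : ∀ g : G, z * g = g * z) (hγ : 0 ≤ γ) (K : ℕ) (μ : Fin 3)
    (s : ZMod ((F.P 0).sitesPerDir 0)) :
    (F.unitLaw ℰ hE γ K).map (GaugeField.ctwist z μ s) = F.unitLaw ℰ hE γ K := by
  -- the unit slice read at level `K` of the `K`-th approximation, and a fine slice averaging to it
  obtain ⟨s₀, hs₀⟩ := BlockAveraging.exists_iter_blockAvg_ctwist (P := F.P K) ℰ hz μ K (Nat.le_add_left K F.m)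
    (coordEquiv (F.sitesPerDir_unit K) s)
  have hA : Measurable ((F.unitFactorisation ℰ hE γ).A K) := (F.unitFactorisation ℰ hE γ).measurable_A K
  have hcomp : (GaugeField.ctwist z μ s ∘ (F.unitFactorisation ℰ hE γ).A K) =
      ((F.unitFactorisation ℰ hE γ).A K ∘ GaugeField.ctwist z μ s₀) := by
    funext U
    show GaugeField.ctwist z μ s (unitShift F K
        (Averaging.iter (fun j => BlockAveraging.blockAvg (P := F.P K) (j := j) ℰ) K U)) =
      unitShift F K (Averaging.iter (fun j => BlockAveraging.blockAvg (P := F.P K) (j := j) ℰ) K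
        (GaugeField.ctwist z μ s₀ U))
    rw [hs₀ U]
    show _ = fieldShift (F.sitesPerDir_unit K) (GaugeField.ctwist z μ (coordEquiv (F.sitesPerDir_unit K) s) _)
    rw [fieldShift_ctwist, RingEquiv.symm_apply_apply]
    rfl
  rw [T3Family.unitLaw, T4VarianceMatching.UnitFactorisation.effLaw,
    Measure.map_map (GaugeField.measurePreserving_ctwist z μ s).measurable hA, hcomp,
    ← Measure.map_map hA (GaugeField.measurePreserving_ctwist (P := (F.scheme ℰ γ).P K) (j := 0) z μ s₀).measurable,
    map_ctwist_gibbsMeasure hz _ (F.scheme_β_nonneg ℰ hγ K)]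

/-- Consequently `∫ g (ctwist z μ s u) d(unitLaw_K) = ∫ g d(unitLaw_K)` for every measurable `g`. [cite: tHooft1979Flux, §2] -/
theorem integral_unitLaw_comp_ctwist {z : G} (hz : ∀ g : G, z * g = g * z) (hγ : 0 ≤ γ) (K : ℕ) (μ : Fin 3)
    (s : ZMod ((F.P 0).sitesPerDir 0)) {g : GaugeField (F.P 0) 0 G → ℝ} (hg : Measurable g) :
    ∫ u, g (GaugeField.ctwist z μ s u) ∂F.unitLaw ℰ hE γ K = ∫ u, g u ∂F.unitLaw ℰ hE γ K := by
  rw [← integral_map (GaugeField.measurePreserving_ctwist z μ s).measurable.aemeasurable hg.aestronglyMeasurable,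
    map_ctwist_unitLaw F ℰ hE hz hγ K μ s]

end UnitLaw

end Literature.MathematicalPhysics.QuantumFieldTheory.Balaban1983to89.T3CentreTwistUnitLaw

end
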